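import Summits.ABC.StewartYu.ArchG3RecLinesHJC
import Summits.ABC.StewartYu.ArchG3RecLinesKJC
import Summits.ABC.StewartYu.ArchG3RecLinesKF
import Summits.ABC.StewartYu.ArchG3RecLinesO
import Summits.ABC.StewartYu.ArchG3LinesAssemblyK
import HarnessLib

/-!
# The archimedean record `ArchG3Rec` — THE CLOSED LETTER LINES HOLD (all levels), and the lines supply of the frame

Support file (theorems only; no named facts). Cell `abc-stewartyu`, route `YuMatveevShapeRat`, crux r2 `ArchCoreRat` (stmt-ABC-20502),
line `arch-g3-frame` v5, seam (B) of the ONE registered stub `Sig.stub_recLinesArch := ∃ c₀, ∀ c ≥ c₀, ArchG3Line.LinesSupplyS c`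
(plan R47/R49′/R50/R50′). The assembly of the four families of `P.LinesClosedK (2^(n−1)) c` (κ = the path bound `2^{n−1}` of the
shaped frame, `SatData.abs_C_le_two_pow`) at the floor `c ≥ 2^68`, for sorted weights `Monotone P.A` and `n ≥ 2`:
* level `0` k-steps and deep k-steps — p4's `kFamilies_of_far` fed with p1's far lines `kstepF_holds`;
* half steps — p5's `halfStepLinesK_holds`;
* odd-node k-steps — p1's `side_odd`/`oddF_holds` and p2's `oddSmall_holds`/`oddJ_holds`/`oddC_holds`;
all on p1's start print `cPRK_two_pow_le` (`≤ 51/25·Z`) and p4's comparison constant `U0_ge`.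
* **`linesClosedK_holds (hn : 2 ≤ n) (hmono : Monotone P.A) (hc : 2^68 ≤ c) : P.LinesClosedK (2^(n−1)) c`**;
* **`ArchG3Line.linesSupplyS_far : ∃ c₀, ∀ c, c₀ ≤ c → LinesSupplyS c`** (`c₀ = 2^68`, via `linesSupplyS_of_closedK_mono`) — the text
  of `Sig.stub_recLinesArch`, discharged by name in p4's closer.

## References
* [Nesterenko2003] Yu. V. Nesterenko, LNM 1819 (2003) — §4 Prop. 4.1, §4.2–4.3; shape only.
* [Matveev2000] E. M. Matveev, Izv. Math. 64 (2000) — §3 (sorted weights); shape only.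
-/

noncomputable section

open Finset Real
open scoped Nat

namespace Summit.ABC.StewartYu

namespace ArchG3Rec

open ArchG3Par (G K yloadK G_eq G_pos)

variable {n : ℕ} (P : ArchG3Rec n)

/-- **THE CLOSED LETTER LINES HOLD AT EVERY LEVEL**: for `n ≥ 2`, sorted weights and `c ≥ 2^68`, `P.LinesClosedK (2^(n−1)) c`
(K0/K: p4 + p1; H: p5; O: p1 + p2). [cite: Nesterenko2003, §4 Prop. 4.1; shape only] -/
theorem linesClosedK_holds (hn2 : 2 ≤ n) (hmono : Monotone P.A) {c : ℝ} (hc : (2 : ℝ) ^ 68 ≤ c) : P.LinesClosedK (2 ^ (n - 1)) c := by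
  have hc63 : (2 : ℝ) ^ (3 + 60) ≤ c := le_trans (by norm_num) hc
  have hc63' : (2 : ℝ) ^ 63 ≤ c := le_trans (by norm_num) hc
  have hc64 : (2 : ℝ) ^ (4 + 60) ≤ c := le_trans (by norm_num) hc
  have hc60 : (2 : ℝ) ^ (0 + 60) ≤ c := le_trans (by norm_num) hc
  have hcP := P.cPRK_two_pow_le hn2
  have hκ : 1 ≤ 2 ^ (n - 1) := Nat.one_le_two_pow
  have hlκ : Real.log ((2 ^ (n - 1) : ℕ) : ℝ) ≤ n * Real.log 2 := by
    push_cast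
    rw [Real.log_pow]
    have hl2 : 0 < Real.log 2 := Real.log_pos one_lt_two
    have h1 : ((n - 1 : ℕ) : ℝ) ≤ n := by exact_mod_cast Nat.sub_le n 1
    nlinarith
  have hU4 : (2 : ℝ) ^ (4 * n) * P.Z ≤ P.U0 c := P.U0_ge 4 hc64
  have hU1 : P.Z ≤ P.U0 c := by have h := P.U0_ge 0 hc60; simpa using h
  -- the two k-step families
  obtain ⟨hK0, hK⟩ := P.kFamilies_of_far hn2 hmono hc (by norm_num : (51 / 25 : ℝ) ≤ 4) hcP
    (fun lev ν hlev hν => P.kstepF_holds hn2 lev ν hν hlev hc63)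
  refine ⟨hK0, fun lev hlev => P.halfStepLinesK_holds hn2 hmono hlev hc63', fun lev hlev => ?_, hK⟩
  -- the odd-node family at `lev + 1`
  obtain ⟨h1, h2, h3, h4⟩ := P.side_odd (lev + 1)
  exact ⟨h1, h2, h3, h4, P.oddSmall_holds hn2 (2 ^ (n - 1)) (lev + 1) (by omega) hU1,
    P.oddJ_holds hn2 hmono hκ hlκ hcP (by norm_num) hU4 (lev + 1) (by omega) (by omega),
    P.oddF_holds hn2 (lev + 1) (by omega) hc63,
    P.oddC_holds hn2 hκ hlκ hcP (by norm_num) hU4 (lev + 1) (by omega) (by omega)⟩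

end ArchG3Rec

namespace ArchG3Line

/-- **THE LINES SUPPLY OF THE SHAPED FRAME, EVENTUALLY IN `c`** — the text of the registered stub `Sig.stub_recLinesArch` of line
`arch-g3-frame` v5: `∃ c₀, ∀ c ≥ c₀, LinesSupplyS c` (`c₀ = 2^68`; `linesClosedK_holds` through `linesSupplyS_of_closedK_mono`).
[cite: Nesterenko2003, §4 Prop. 4.1; shape only] -/
theorem linesSupplyS_far : ∃ c₀ : ℝ, ∀ c : ℝ, c₀ ≤ c → LinesSupplyS c :=
  ⟨2 ^ 68, fun _ hc => linesSupplyS_of_closedK_mono fun _ hn P hmono => P.linesClosedK_holds hn hmono hc⟩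

end ArchG3Line

end Summit.ABC.StewartYu

end
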